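import Mathlib
import Summits.MatrixMultiplication.MatrixMultiplication.Theses.FidelityWitnesses
import Summits.MatrixMultiplication.MatrixMultiplication.Theorems.FidelityWitnessesDiagonalPowerDecayGlue
import Summits.MatrixMultiplication.MatrixMultiplication.Theorems.FidelityWitnessesDiagonalPowerDecayBlockSelfSimilarity

/-!
# Line `qualitative-decay-bounded-synergy` for crux `FidelityWitnesses.DiagonalPowerDecay`
# (stmt-MatrixMultiplication-14053) — the wall-breaker strategist's skeleton (2026-08-17)

THE CRUX. `DiagonalPowerDecay : ∃ C δ, 0 < δ ∧ ∀ n S, tensorRank S ≤ n² → |⟨S,T_n⟩|² ≤ C·n^{3−2δ}·‖S‖²`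
(`T_n = matMulTensor ℂ n n n`, `‖T_n‖² = n³`; `M(n) := M(n,n²) = sup |⟨S,T_n⟩|²/‖S‖²` over `R(S) ≤ n²`, `φ(n) = M(n)/n³`;
the crux is `γ := lim log_n M(n) < 3`, the limit existing by Kronecker super-multiplicativity `M(nm) ≥ M(n)M(m)`).

WHY THIS LINE EXISTS.  Every earlier line (NEG `frame-negativity-singlet-fraction`, NUC `unit-tensor-orbit-nuclear-ratio`,
VTX `vertex-flattening-factor-rank`) died with exactly ONE open stub that was `≥` the crux in truth value (⟺ crux; ⟹ crux;
= the route target `2 < ω(ℂ)`).  The leads' certificate "every concluding line contains a stub `≥ 2<ω`" holds for the JOINT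
stub set of any sound line (unavoidable on a refutation route) but not stub by stub.  This skeleton cuts the crux into TWO
statements EACH INDIVIDUALLY CONSISTENT WITH `ω(ℂ) = 2`, neither of which is the crux reworded
(STRATEGY-CENSUS.md § 3 D1, `Cruxes/DiagonalPowerDecay/STRATEGY-CENSUS.md`):

REGISTERED STUBS (2) and composition:
* `stub_qualitativeDiagonalDecay` — QUALITATIVE DIAGONAL DECAY `φ(n) → 0` (no rate): verbatim the hypothesis of the landed
  `superlinear_tensorRank_of_qualitativeDecay` (p120930).  Strictly WEAKER than the crux (`qualitativeDecay_of_diagonalPowerDecay`),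
  consistent with `ω(ℂ) = 2`, and already theorem-grade: it forces `R(⟨m,m,m⟩)/m² → ∞` and `R̲(⟨m,m,m⟩)/m² → ∞` (p121281).
  Graded ladder (first rungs inside KNOWN technology): `φ ≤ 5/6` landed (`koszulWitness`, p = 1 Koszul) → `1/2 + O(1/n)` (the
  Koszul family floor = `bR ≥ 2n² − n` in witness form) → any constant `< 1/2` is a border-rank bound `> 2n²` for `⟨n,n,n⟩`
  (`< 1/4` at `n = 2m` is `R̲(⟨m,m,m⟩) > 2m²`, beyond Landsberg–Michałek) → `1/6` cactus floor of the linear class → `o(1)` needs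
  a non-linear n-uniform witness.  Size: open problem (superlinear border rank), with provable-now rungs.
* `stub_boundedSynergy` — BOUNDED SYNERGY: capture bounds TENSORISE up to a constant, `∃C ∀n m, M(n·m) ≤ C·M(n)·M(m)` in
  witness form.  The approximate converse of super-multiplicativity; informally (Fekete) `φ(n) ≥ c·n^{γ−3}` for every `n` —
  the capture exponent is ATTAINED up to a constant at every scale.  It does NOT imply the crux (`φ ≡ const` satisfies it),
  is NOT implied by it, is consistent with `ω(ℂ) = 2`.  Size: conjecture-grade; natural attack = a TWO-SCALE COMPRESSION
  LEMMA for `T_{nm} = T_n ⊠ T_m` (`tr(P_E(P_{A_n}⊗P_{A_m})) = Σ_t tr(Q_t P_{A_n})` over a basis of `A_m`; show the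
  compressions `Q_t` of a product-spanned projector are dominated by product-spanned projectors of the first scale of
  total dimension `≤ C·(nm)²`).  Cheapest falsifier: Kronecker-seeded synergy ratios `M(nm)/(M(n)M(m))` (kit job of this seat;
  known `M(4,16)/M(2,4)² ≈ 1.13`).
* `DiagonalPowerDecay_of : QD → BS → DiagonalPowerDecay` — KERNEL-CHECKED, no `sorry` of its own: one small scale from QD
  (`M(n₁) ≤ n₁³/2C`), iterate BS along `n₁^{k+1} = n₁^k·n₁` (`M(n₁^k) ≤ (n₁³/2)^k`), padding monotonicity (`split_capture_pad`)
  for the `n` between powers, `n₁^{1/n₁} ≤ 2`; witness `δ = 1/(2n₁)`, `C = n₁³`.  `DiagonalPowerDecay_closed` wires the stubs in.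
  (Identical proof in `Cruxes/DiagonalPowerDecay/Split.lean` as `DiagonalPowerDecay_of_subs`, with the corollary
  `diagonalPowerDecay_iff_qualitativeDecay_of_boundedSynergy`: under BS the crux ⟺ QD.)

FOR THE LEAD (read the card `Lines/qualitative-decay-bounded-synergy.md` first).  Neither stub closes in a cycle; the
productive moves are: (i) LAND `Split.lean` verbatim under `Theorems/FidelityWitnessesDiagonalPowerDecaySplit.lean`
(`--supports stmt-14053`; planners cannot write Theorems); (ii) stub-workers on the QD LADDER rung `φ ≤ 1/2 + O(1/n)`
(optimal Koszul exponent in witness form, `--supports`); (iii) read the synergy numerics; attempt the two-scale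
compression lemma at `(n,m) = (2,2)` exactly; (iv) ON YOUR FINAL CYCLE file the prepared split
(`route edit --split DiagonalPowerDecay --into children.json`, children = the two stub statements verbatim; the strategist's
`route edit --split` was refused only by the final-cycle rule) so QD and BS become first-class sub-cruxes with their own chains.

Disproof lane honoured (`Cruxes/DiagonalPowerDecay/Disproof.lean`, cdisprove cycle 1 final): `false_without_rank` — the budget
enters both stubs at full strength (`R(S) ≤ n²`, `≤ m²`, `≤ (nm)²`); `dpd_iff_unit_constant` / `body_one_of_body` — matches the
free constants (`C` of BS is absorbed, the crux's `C = n₁³` is immaterial); the δ-caps (`delta_lt_three_sevenths`,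
`CertN4.delta_lt : δ < 41/106`) constrain only the witness `δ = 1/(2n₁)`, which is as small as QD's threshold makes it —
consistent; `not_dpd_iff` — a kill of the crux is a family with `γ = 3`; under BS such a family kills QD at ONE scale, under QD
it kills BS, so the two stubs share the crux's exposure without either being the crux.  No `Negative/` lemma exists.
-/

set_option linter.dupNamespace false

noncomputable section

namespace Summit.MatrixMultiplication.MatrixMultiplication.Cruxes.DiagonalPowerDecay.QualitativeDecayBoundedSynergy

open scoped BigOperators
open Literature.Computability.AlgebraicComplexity
open Summit.MatrixMultiplication.MatrixMultiplication.Theses.FidelityWitnesses (DiagonalPowerDecay)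
open Summit.MatrixMultiplication.MatrixMultiplication.Theorems
open Summit.MatrixMultiplication.MatrixMultiplication.Theorems.DiagonalPowerDecay

/-! ## Padding monotonicity `M(n) ≤ M(N)` for `n ≤ N`, in witness form -/

/-- **Padding monotonicity.**  A capture bound `B` valid for every rank-`≤ N²` tensor of the `N × N` format is valid
for every rank-`≤ n²` tensor of the `n × n` format, `n ≤ N`: zero-pad `S` along `e = castLE × castLE` in restriction
normal form `S' x y z = Σ_{abc} [e a = x][e b = y][e c = z]·S_{abc}` (`R(S') ≤ R(S) ≤ n² ≤ N²`, same overlap with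
`⟨N,N,N⟩ ∘ e³ = ⟨n,n,n⟩`, same norm). [folklore] -/
theorem split_capture_pad {n N : ℕ} (h : n ≤ N) {B : ℝ}
    (hB : ∀ S : (Fin N × Fin N) → (Fin N × Fin N) → (Fin N × Fin N) → ℂ, tensorRank S ≤ N ^ 2 →
      ‖∑ a, ∑ b, ∑ c, S a b c * matMulTensor ℂ N N N a b c‖ ^ 2 ≤ B * ∑ a, ∑ b, ∑ c, ‖S a b c‖ ^ 2)
    (S : (Fin n × Fin n) → (Fin n × Fin n) → (Fin n × Fin n) → ℂ) (hS : tensorRank S ≤ n ^ 2) :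
    ‖∑ a, ∑ b, ∑ c, S a b c * matMulTensor ℂ n n n a b c‖ ^ 2 ≤ B * ∑ a, ∑ b, ∑ c, ‖S a b c‖ ^ 2 := by
  classical
  -- the coordinate embedding
  set e : Fin n × Fin n → Fin N × Fin N := Prod.map (Fin.castLE h) (Fin.castLE h) with he
  have hinj : Function.Injective e := (Fin.castLE_injective h).prodMap (Fin.castLE_injective h)
  have hT : ∀ a b c, matMulTensor ℂ N N N (e a) (e b) (e c) = matMulTensor ℂ n n n a b c := by
    intro a b c
    rw [Literature.CplxAlg.matMulTensor_eq_comp_castLE ℂ h]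
  -- the padded tensor, in restriction normal form
  obtain ⟨S', hS'⟩ : ∃ S' : (Fin N × Fin N) → (Fin N × Fin N) → (Fin N × Fin N) → ℂ, ∀ x y z,
      S' x y z = ∑ a, ∑ b, ∑ c, (if e a = x then (1 : ℂ) else 0) * (if e b = y then (1 : ℂ) else 0) *
        (if e c = z then (1 : ℂ) else 0) * S a b c :=
    ⟨fun x y z => ∑ a, ∑ b, ∑ c, (if e a = x then (1 : ℂ) else 0) *
      (if e b = y then (1 : ℂ) else 0) * (if e c = z then (1 : ℂ) else 0) * S a b c, fun _ _ _ => rfl⟩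
  -- rank: `S'` is a restriction of `S`
  have hRank : tensorRank S' ≤ tensorRank S :=
    TensorRestrictsTo.tensorRank_le ⟨fun x a => if e a = x then (1 : ℂ) else 0,
      fun y b => if e b = y then (1 : ℂ) else 0, fun z c => if e c = z then (1 : ℂ) else 0, hS'⟩
  -- values on the box
  have hOn : ∀ a b c, S' (e a) (e b) (e c) = S a b c := by
    intro a₀ b₀ c₀
    rw [hS']
    simp only [hinj.eq_iff]
    rw [Finset.sum_eq_single a₀, Finset.sum_eq_single b₀, Finset.sum_eq_single c₀]
    · simp
    all_goals first
      | (intro i _ hi; simp [hi])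
      | simp
  -- values off the box
  have hOffx : ∀ x, (∀ a, e a ≠ x) → ∀ y z, S' x y z = 0 := fun x hx y z => by
    rw [hS']
    exact Finset.sum_eq_zero fun a _ => Finset.sum_eq_zero fun b _ =>
      Finset.sum_eq_zero fun c _ => by simp [hx a]
  have hOffy : ∀ y, (∀ b, e b ≠ y) → ∀ x z, S' x y z = 0 := fun y hy x z => by
    rw [hS']
    exact Finset.sum_eq_zero fun a _ => Finset.sum_eq_zero fun b _ =>
      Finset.sum_eq_zero fun c _ => by simp [hy b]
  have hOffz : ∀ z, (∀ c, e c ≠ z) → ∀ x y, S' x y z = 0 := fun z hz x y => by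
    rw [hS']
    exact Finset.sum_eq_zero fun a _ => Finset.sum_eq_zero fun b _ =>
      Finset.sum_eq_zero fun c _ => by simp [hz c]
  -- overlap with `⟨N,N,N⟩` = overlap with `⟨n,n,n⟩`
  have hOver : (∑ x, ∑ y, ∑ z, S' x y z * matMulTensor ℂ N N N x y z) =
      ∑ a, ∑ b, ∑ c, S a b c * matMulTensor ℂ n n n a b c :=
    calc (∑ x, ∑ y, ∑ z, S' x y z * matMulTensor ℂ N N N x y z)
        = ∑ a, ∑ y, ∑ z, S' (e a) y z * matMulTensor ℂ N N N (e a) y z :=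
          dpdGlue_sum_eq_sum_emb hinj _ fun x hx => by
            simp only [hOffx x hx, zero_mul, Finset.sum_const_zero]
      _ = ∑ a, ∑ b, ∑ z, S' (e a) (e b) z * matMulTensor ℂ N N N (e a) (e b) z :=
          Finset.sum_congr rfl fun a _ => dpdGlue_sum_eq_sum_emb hinj _ fun y hy => by
            simp only [hOffy y hy, zero_mul, Finset.sum_const_zero]
      _ = ∑ a, ∑ b, ∑ c, S' (e a) (e b) (e c) * matMulTensor ℂ N N N (e a) (e b) (e c) :=
          Finset.sum_congr rfl fun a _ => Finset.sum_congr rfl fun b _ =>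
            dpdGlue_sum_eq_sum_emb hinj _ fun z hz => by
              simp only [hOffz z hz, zero_mul]
      _ = ∑ a, ∑ b, ∑ c, S a b c * matMulTensor ℂ n n n a b c := by
          simp only [hOn, hT]
  -- squared norm is preserved
  have hNorm : (∑ x, ∑ y, ∑ z, ‖S' x y z‖ ^ 2) = ∑ a, ∑ b, ∑ c, ‖S a b c‖ ^ 2 :=
    calc (∑ x, ∑ y, ∑ z, ‖S' x y z‖ ^ 2)
        = ∑ a, ∑ y, ∑ z, ‖S' (e a) y z‖ ^ 2 :=
          dpdGlue_sum_eq_sum_emb hinj _ fun x hx => by simp [hOffx x hx]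
      _ = ∑ a, ∑ b, ∑ z, ‖S' (e a) (e b) z‖ ^ 2 :=
          Finset.sum_congr rfl fun a _ => dpdGlue_sum_eq_sum_emb hinj _ fun y hy => by
            simp [hOffy y hy]
      _ = ∑ a, ∑ b, ∑ c, ‖S' (e a) (e b) (e c)‖ ^ 2 :=
          Finset.sum_congr rfl fun a _ => Finset.sum_congr rfl fun b _ =>
            dpdGlue_sum_eq_sum_emb hinj _ fun z hz => by simp [hOffz z hz]
      _ = ∑ a, ∑ b, ∑ c, ‖S a b c‖ ^ 2 := by simp only [hOn]
  -- the bound at `S'`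
  have hS'rank : tensorRank S' ≤ N ^ 2 := hRank.trans (hS.trans (Nat.pow_le_pow_left h 2))
  have key := hB S' hS'rank
  rwa [hOver, hNorm] at key

/-! ## Bookkeeping in one format: transport along `n = n'` and weakening of the bound -/

/-- Transport of a capture bound along an equality of formats. [folklore] -/
theorem split_cap_congr {n n' : ℕ} (h : n = n') {B : ℝ}
    (hB : ∀ S : (Fin n × Fin n) → (Fin n × Fin n) → (Fin n × Fin n) → ℂ, tensorRank S ≤ n ^ 2 →
      ‖∑ a, ∑ b, ∑ c, S a b c * matMulTensor ℂ n n n a b c‖ ^ 2 ≤ B * ∑ a, ∑ b, ∑ c, ‖S a b c‖ ^ 2) :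
    ∀ S : (Fin n' × Fin n') → (Fin n' × Fin n') → (Fin n' × Fin n') → ℂ, tensorRank S ≤ n' ^ 2 →
      ‖∑ a, ∑ b, ∑ c, S a b c * matMulTensor ℂ n' n' n' a b c‖ ^ 2 ≤ B * ∑ a, ∑ b, ∑ c, ‖S a b c‖ ^ 2 := by
  subst h
  exact hB

/-- Weakening of a capture bound `B ≤ B'`. [folklore] -/
theorem split_cap_mono {n : ℕ} {B B' : ℝ} (hBB' : B ≤ B')
    (hB : ∀ S : (Fin n × Fin n) → (Fin n × Fin n) → (Fin n × Fin n) → ℂ, tensorRank S ≤ n ^ 2 →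
      ‖∑ a, ∑ b, ∑ c, S a b c * matMulTensor ℂ n n n a b c‖ ^ 2 ≤ B * ∑ a, ∑ b, ∑ c, ‖S a b c‖ ^ 2) :
    ∀ S : (Fin n × Fin n) → (Fin n × Fin n) → (Fin n × Fin n) → ℂ, tensorRank S ≤ n ^ 2 →
      ‖∑ a, ∑ b, ∑ c, S a b c * matMulTensor ℂ n n n a b c‖ ^ 2 ≤ B' * ∑ a, ∑ b, ∑ c, ‖S a b c‖ ^ 2 := by
  intro S hS
  have hsum : 0 ≤ ∑ a : Fin n × Fin n, ∑ b : Fin n × Fin n, ∑ c : Fin n × Fin n, ‖S a b c‖ ^ 2 := by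
    positivity
  exact (hB S hS).trans (mul_le_mul_of_nonneg_right hBB' hsum)

/-! ## Real-number bookkeeping: `n₁^{1/n₁} ≤ 2` and the final exponent comparison -/

/-- `x^{1/x} ≤ 2` at every natural number `x = n₁ ≥ 1` (from `n₁ ≤ 2^{n₁}`). [folklore] -/
theorem split_rpow_inv_le_two {n₁ : ℕ} (hn : 1 ≤ n₁) :
    (n₁ : ℝ) ^ ((n₁ : ℝ)⁻¹) ≤ 2 := by
  have hx0 : (0 : ℝ) < n₁ := by exact_mod_cast hn
  have hle : (n₁ : ℝ) ≤ (2 : ℝ) ^ (n₁ : ℝ) := by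
    rw [Real.rpow_natCast]
    exact_mod_cast (Nat.lt_two_pow_self).le
  calc (n₁ : ℝ) ^ ((n₁ : ℝ)⁻¹) ≤ ((2 : ℝ) ^ (n₁ : ℝ)) ^ ((n₁ : ℝ)⁻¹) :=
        Real.rpow_le_rpow hx0.le hle (inv_nonneg.2 hx0.le)
    _ = 2 := by
        rw [← Real.rpow_mul (by norm_num : (0 : ℝ) ≤ 2), mul_inv_cancel₀ hx0.ne', Real.rpow_one]

/-- The exponent comparison: for `n₁ ≥ 2` and `n₁^j ≤ n`,
`(n₁³/2)^{j+1} ≤ n₁³ · n^{3 − 1/n₁}`. [folklore] -/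
theorem split_bound_compare {n₁ j n : ℕ} (hn₁ : 2 ≤ n₁) (hjn : n₁ ^ j ≤ n) :
    ((n₁ : ℝ) ^ 3 / 2) ^ (j + 1) ≤ (n₁ : ℝ) ^ 3 * (n : ℝ) ^ ((3 : ℝ) - (n₁ : ℝ)⁻¹) := by
  have hx0 : (0 : ℝ) < n₁ := by exact_mod_cast (by omega : 0 < n₁)
  have hx1 : (1 : ℝ) ≤ n₁ := by exact_mod_cast (by omega : 1 ≤ n₁)
  -- exponent `3 − 1/n₁ ≥ 0`
  have hinv1 : (n₁ : ℝ)⁻¹ ≤ 1 := inv_le_one_of_one_le₀ hx1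
  have hexp0 : (0 : ℝ) ≤ 3 - (n₁ : ℝ)⁻¹ := by linarith
  -- one step: `n₁³/2 ≤ n₁^{3 − 1/n₁}`
  have hstep : (n₁ : ℝ) ^ 3 / 2 ≤ (n₁ : ℝ) ^ ((3 : ℝ) - (n₁ : ℝ)⁻¹) := by
    have h2 := split_rpow_inv_le_two (by omega : 1 ≤ n₁)
    have hpos : (0 : ℝ) < (n₁ : ℝ) ^ ((n₁ : ℝ)⁻¹) := Real.rpow_pos_of_pos hx0 _
    rw [Real.rpow_sub hx0, show ((3 : ℝ)) = ((3 : ℕ) : ℝ) by norm_num, Real.rpow_natCast,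
      div_le_div_iff₀ (by norm_num : (0 : ℝ) < 2) hpos]
    exact mul_le_mul_of_nonneg_left h2 (by positivity)
  -- `j` steps: `(n₁³/2)^j ≤ (n₁^j)^{3 − 1/n₁} ≤ n^{3 − 1/n₁}`
  have hpowj : ((n₁ : ℝ) ^ 3 / 2) ^ j ≤ (n : ℝ) ^ ((3 : ℝ) - (n₁ : ℝ)⁻¹) :=
    calc ((n₁ : ℝ) ^ 3 / 2) ^ j ≤ ((n₁ : ℝ) ^ ((3 : ℝ) - (n₁ : ℝ)⁻¹)) ^ j :=
          pow_le_pow_left₀ (by positivity) hstep j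
      _ = (((n₁ : ℝ) ^ j) ^ ((3 : ℝ) - (n₁ : ℝ)⁻¹)) := by
          rw [← Real.rpow_mul_natCast hx0.le, mul_comm, Real.rpow_natCast_mul hx0.le]
      _ ≤ (n : ℝ) ^ ((3 : ℝ) - (n₁ : ℝ)⁻¹) := by
          refine Real.rpow_le_rpow (by positivity) ?_ hexp0
          exact_mod_cast hjn
  -- assemble
  have h3 : (n₁ : ℝ) ^ 3 / 2 ≤ (n₁ : ℝ) ^ 3 := by
    have : (0 : ℝ) ≤ (n₁ : ℝ) ^ 3 := by positivity
    linarith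
  calc ((n₁ : ℝ) ^ 3 / 2) ^ (j + 1) = (n₁ : ℝ) ^ 3 / 2 * ((n₁ : ℝ) ^ 3 / 2) ^ j := by ring
    _ ≤ (n₁ : ℝ) ^ 3 * (n : ℝ) ^ ((3 : ℝ) - (n₁ : ℝ)⁻¹) :=
        mul_le_mul h3 hpowj (by positivity) (by positivity)


/-! ## The two registered stubs -/

/-- **Stub 1 — QUALITATIVE DIAGONAL DECAY** (`φ(n) → 0`, no rate; child `QualitativeDiagonalDecay` of the prepared split):
for every `ε > 0`, eventually in `n`, every tensor of rank `≤ n²` captures at most `ε·n³` of `⟨n,n,n⟩`.  Weaker than the crux,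
consistent with `ω(ℂ) = 2`, forces superlinear (border) rank of `⟨m,m,m⟩` (p120930/p121281).  OPEN. -/
theorem stub_qualitativeDiagonalDecay :
    ∀ ε : ℝ, 0 < ε → ∃ N : ℕ, ∀ n : ℕ, N ≤ n →
      ∀ S : (Fin n × Fin n) → (Fin n × Fin n) → (Fin n × Fin n) → ℂ, tensorRank S ≤ n ^ 2 →
        ‖∑ a, ∑ b, ∑ c, S a b c * matMulTensor ℂ n n n a b c‖ ^ 2 ≤
          ε * (n : ℝ) ^ 3 * ∑ a, ∑ b, ∑ c, ‖S a b c‖ ^ 2 := by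
  sorry

/-- **Stub 2 — BOUNDED SYNERGY** (`M(n·m) ≤ C·M(n)·M(m)` in witness form; child `BoundedSynergy` of the prepared split):
capture bounds for the `n × n` and `m × m` formats tensorise, up to a universal constant, to the `(nm) × (nm)` format.
Neither implies nor is implied by the crux; consistent with `ω(ℂ) = 2`.  OPEN (conjecture-grade). -/
theorem stub_boundedSynergy :
    ∃ C : ℝ, ∀ n m : ℕ, ∀ Bn Bm : ℝ,
      (∀ S : (Fin n × Fin n) → (Fin n × Fin n) → (Fin n × Fin n) → ℂ, tensorRank S ≤ n ^ 2 →
        ‖∑ a, ∑ b, ∑ c, S a b c * matMulTensor ℂ n n n a b c‖ ^ 2 ≤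
          Bn * ∑ a, ∑ b, ∑ c, ‖S a b c‖ ^ 2) →
      (∀ S : (Fin m × Fin m) → (Fin m × Fin m) → (Fin m × Fin m) → ℂ, tensorRank S ≤ m ^ 2 →
        ‖∑ a, ∑ b, ∑ c, S a b c * matMulTensor ℂ m m m a b c‖ ^ 2 ≤
          Bm * ∑ a, ∑ b, ∑ c, ‖S a b c‖ ^ 2) →
      ∀ S : (Fin (n * m) × Fin (n * m)) → (Fin (n * m) × Fin (n * m)) → (Fin (n * m) × Fin (n * m)) → ℂ,
        tensorRank S ≤ (n * m) ^ 2 →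
        ‖∑ a, ∑ b, ∑ c, S a b c * matMulTensor ℂ (n * m) (n * m) (n * m) a b c‖ ^ 2 ≤
          C * Bn * Bm * ∑ a, ∑ b, ∑ c, ‖S a b c‖ ^ 2 := by
  sorry

/-! ## The composition (kernel-checked, no `sorry` of its own) -/

/-- **`DiagonalPowerDecay` from the two stubs' STATEMENTS** (hypotheses spelled out; identical to
`DiagonalPowerDecay_of_subs` of `Cruxes/DiagonalPowerDecay/Split.lean`): witness `(C, δ) = (n₁³, 1/(2n₁))`. [folklore] -/
theorem DiagonalPowerDecay_of
    (hQ : ∀ ε : ℝ, 0 < ε → ∃ N : ℕ, ∀ n : ℕ, N ≤ n →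
      ∀ S : (Fin n × Fin n) → (Fin n × Fin n) → (Fin n × Fin n) → ℂ, tensorRank S ≤ n ^ 2 →
        ‖∑ a, ∑ b, ∑ c, S a b c * matMulTensor ℂ n n n a b c‖ ^ 2 ≤
          ε * (n : ℝ) ^ 3 * ∑ a, ∑ b, ∑ c, ‖S a b c‖ ^ 2)
    (hBS : ∃ C : ℝ, ∀ n m : ℕ, ∀ Bn Bm : ℝ,
      (∀ S : (Fin n × Fin n) → (Fin n × Fin n) → (Fin n × Fin n) → ℂ, tensorRank S ≤ n ^ 2 →
        ‖∑ a, ∑ b, ∑ c, S a b c * matMulTensor ℂ n n n a b c‖ ^ 2 ≤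
          Bn * ∑ a, ∑ b, ∑ c, ‖S a b c‖ ^ 2) →
      (∀ S : (Fin m × Fin m) → (Fin m × Fin m) → (Fin m × Fin m) → ℂ, tensorRank S ≤ m ^ 2 →
        ‖∑ a, ∑ b, ∑ c, S a b c * matMulTensor ℂ m m m a b c‖ ^ 2 ≤
          Bm * ∑ a, ∑ b, ∑ c, ‖S a b c‖ ^ 2) →
      ∀ S : (Fin (n * m) × Fin (n * m)) → (Fin (n * m) × Fin (n * m)) → (Fin (n * m) × Fin (n * m)) → ℂ,
        tensorRank S ≤ (n * m) ^ 2 →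
        ‖∑ a, ∑ b, ∑ c, S a b c * matMulTensor ℂ (n * m) (n * m) (n * m) a b c‖ ^ 2 ≤
          C * Bn * Bm * ∑ a, ∑ b, ∑ c, ‖S a b c‖ ^ 2) :
    DiagonalPowerDecay := by
  classical
  -- (0) the synergy constant, w.l.o.g. `≥ 1`
  obtain ⟨C₀, hC₀⟩ := hBS
  set C : ℝ := max C₀ 1 with hCdef
  have hC1 : 1 ≤ C := le_max_right _ _
  have hC0 : 0 < C := lt_of_lt_of_le one_pos hC1
  have hBS' : ∀ (n m : ℕ) (Bn Bm : ℝ), 0 ≤ Bn → 0 ≤ Bm →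
      (∀ S : (Fin n × Fin n) → (Fin n × Fin n) → (Fin n × Fin n) → ℂ, tensorRank S ≤ n ^ 2 →
        ‖∑ a, ∑ b, ∑ c, S a b c * matMulTensor ℂ n n n a b c‖ ^ 2 ≤
          Bn * ∑ a, ∑ b, ∑ c, ‖S a b c‖ ^ 2) →
      (∀ S : (Fin m × Fin m) → (Fin m × Fin m) → (Fin m × Fin m) → ℂ, tensorRank S ≤ m ^ 2 →
        ‖∑ a, ∑ b, ∑ c, S a b c * matMulTensor ℂ m m m a b c‖ ^ 2 ≤
          Bm * ∑ a, ∑ b, ∑ c, ‖S a b c‖ ^ 2) →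
      ∀ S : (Fin (n * m) × Fin (n * m)) → (Fin (n * m) × Fin (n * m)) → (Fin (n * m) × Fin (n * m)) → ℂ,
        tensorRank S ≤ (n * m) ^ 2 →
        ‖∑ a, ∑ b, ∑ c, S a b c * matMulTensor ℂ (n * m) (n * m) (n * m) a b c‖ ^ 2 ≤
          C * Bn * Bm * ∑ a, ∑ b, ∑ c, ‖S a b c‖ ^ 2 := by
    intro n m Bn Bm hBn hBm hn hm S hS
    have hsum : 0 ≤ ∑ a : Fin (n * m) × Fin (n * m), ∑ b : Fin (n * m) × Fin (n * m),
        ∑ c : Fin (n * m) × Fin (n * m), ‖S a b c‖ ^ 2 := by positivity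
    calc ‖∑ a, ∑ b, ∑ c, S a b c * matMulTensor ℂ (n * m) (n * m) (n * m) a b c‖ ^ 2
        ≤ C₀ * Bn * Bm * ∑ a, ∑ b, ∑ c, ‖S a b c‖ ^ 2 := hC₀ n m Bn Bm hn hm S hS
      _ ≤ C * Bn * Bm * ∑ a, ∑ b, ∑ c, ‖S a b c‖ ^ 2 := by
          refine mul_le_mul_of_nonneg_right ?_ hsum
          have : C₀ ≤ C := le_max_left _ _
          have hBB : 0 ≤ Bn * Bm := mul_nonneg hBn hBm
          nlinarith
  -- (1) one small scale from qualitative decay: `M(n₁) ≤ n₁³/(2C)`, `n₁ ≥ 2`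
  obtain ⟨N, hN⟩ := hQ (1 / (2 * C)) (by positivity)
  set n₁ : ℕ := max N 2 with hn₁def
  have hn₁2 : 2 ≤ n₁ := le_max_right _ _
  have hNn₁ : N ≤ n₁ := le_max_left _ _
  have hx0 : (0 : ℝ) < n₁ := by exact_mod_cast (by omega : 0 < n₁)
  have hbase : ∀ S : (Fin n₁ × Fin n₁) → (Fin n₁ × Fin n₁) → (Fin n₁ × Fin n₁) → ℂ,
      tensorRank S ≤ n₁ ^ 2 →
        ‖∑ a, ∑ b, ∑ c, S a b c * matMulTensor ℂ n₁ n₁ n₁ a b c‖ ^ 2 ≤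
          (1 / (2 * C) * (n₁ : ℝ) ^ 3) * ∑ a, ∑ b, ∑ c, ‖S a b c‖ ^ 2 := by
    intro S hS
    have := hN n₁ hNn₁ S hS
    simpa [mul_assoc] using this
  have hbase0 : 0 ≤ 1 / (2 * C) * (n₁ : ℝ) ^ 3 := by positivity
  -- (2) iteration of bounded synergy along `n₁^{k+1} = n₁^k · n₁`: `M(n₁^{k+1}) ≤ (n₁³/2)^{k+1}`
  have hiter : ∀ k : ℕ, ∀ S : (Fin (n₁ ^ (k + 1)) × Fin (n₁ ^ (k + 1))) →
      (Fin (n₁ ^ (k + 1)) × Fin (n₁ ^ (k + 1))) → (Fin (n₁ ^ (k + 1)) × Fin (n₁ ^ (k + 1))) → ℂ,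
      tensorRank S ≤ (n₁ ^ (k + 1)) ^ 2 →
        ‖∑ a, ∑ b, ∑ c, S a b c * matMulTensor ℂ (n₁ ^ (k + 1)) (n₁ ^ (k + 1)) (n₁ ^ (k + 1)) a b c‖ ^ 2 ≤
          ((n₁ : ℝ) ^ 3 / 2) ^ (k + 1) * ∑ a, ∑ b, ∑ c, ‖S a b c‖ ^ 2 := by
    intro k
    induction k with
    | zero =>
      -- format `n₁ ^ 1 = n₁`; bound `n₁³/(2C) ≤ (n₁³/2)^1`
      have hle : 1 / (2 * C) * (n₁ : ℝ) ^ 3 ≤ ((n₁ : ℝ) ^ 3 / 2) ^ (0 + 1) := by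
        rw [zero_add, pow_one, div_eq_mul_one_div ((n₁ : ℝ) ^ 3), mul_comm]
        refine mul_le_mul_of_nonneg_left ?_ (by positivity)
        rw [div_le_div_iff₀ (by positivity) (by norm_num : (0 : ℝ) < 2)]
        linarith
      exact split_cap_congr (pow_one n₁).symm (split_cap_mono hle hbase)
    | succ k ih =>
      -- `BS` at `(n₁^{k+1}, n₁)` with bounds `(n₁³/2)^{k+1}` and `n₁³/(2C)`
      have hprod := hBS' (n₁ ^ (k + 1)) n₁ (((n₁ : ℝ) ^ 3 / 2) ^ (k + 1)) (1 / (2 * C) * (n₁ : ℝ) ^ 3)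
        (by positivity) hbase0 ih hbase
      have hval : C * ((n₁ : ℝ) ^ 3 / 2) ^ (k + 1) * (1 / (2 * C) * (n₁ : ℝ) ^ 3) =
          ((n₁ : ℝ) ^ 3 / 2) ^ (k + 1 + 1) := by
        field_simp
        ring
      rw [hval] at hprod
      exact split_cap_congr (pow_succ n₁ (k + 1)).symm hprod
  -- (3) the witness `(C, δ) = (n₁³, 1/(2n₁))`
  refine ⟨(n₁ : ℝ) ^ 3, 1 / (2 * (n₁ : ℝ)), by positivity, fun n S hS => ?_⟩
  have hexp : (3 : ℝ) - 2 * (1 / (2 * (n₁ : ℝ))) = 3 - (n₁ : ℝ)⁻¹ := by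
    field_simp
  rw [hexp]
  rcases Nat.eq_zero_or_pos n with rfl | hn
  · -- the `0 × 0` format: both sides vanish
    simp
  · -- `n₁^j ≤ n < n₁^{j+1}` with `j = Nat.log n₁ n`; pad `S` into the `n₁^{j+1}` format
    set j : ℕ := Nat.log n₁ n with hjdef
    have hlt : n < n₁ ^ (j + 1) := Nat.lt_pow_succ_log_self (by omega : 1 < n₁) n
    have hle : n₁ ^ j ≤ n := Nat.pow_log_le_self n₁ (by omega : n ≠ 0)
    have hcap := split_capture_pad hlt.le (hiter j) S hS
    have hsum : 0 ≤ ∑ a : Fin n × Fin n, ∑ b : Fin n × Fin n, ∑ c : Fin n × Fin n, ‖S a b c‖ ^ 2 := by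
      positivity
    calc ‖∑ a, ∑ b, ∑ c, S a b c * matMulTensor ℂ n n n a b c‖ ^ 2
        ≤ ((n₁ : ℝ) ^ 3 / 2) ^ (j + 1) * ∑ a, ∑ b, ∑ c, ‖S a b c‖ ^ 2 := hcap
      _ ≤ (n₁ : ℝ) ^ 3 * (n : ℝ) ^ ((3 : ℝ) - (n₁ : ℝ)⁻¹) * ∑ a, ∑ b, ∑ c, ‖S a b c‖ ^ 2 :=
          mul_le_mul_of_nonneg_right (split_bound_compare hn₁2 hle) hsum

/-- The skeleton closes the crux BY NAME once both stubs are proved (this declaration inherits their `sorry`s and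
nothing else). -/
theorem DiagonalPowerDecay_closed : DiagonalPowerDecay :=
  DiagonalPowerDecay_of stub_qualitativeDiagonalDecay stub_boundedSynergy

end Summit.MatrixMultiplication.MatrixMultiplication.Cruxes.DiagonalPowerDecay.QualitativeDecayBoundedSynergy

end
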